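import Summits.ResolutionOfSingularities.ResolutionOfSingularities.Theorems.FrobeniusLadderFRationalResolutionTightClosurePowerStepCC
import Summits.ResolutionOfSingularities.ResolutionOfSingularities.Theorems.FrobeniusLadderFRationalResolutionTightClosureOfPowers
import Summits.ResolutionOfSingularities.ResolutionOfSingularities.Theorems.FrobeniusLadderFRationalResolutionColonCapturingSopPow
import Summits.ResolutionOfSingularities.ResolutionOfSingularities.Theorems.FrobeniusLadderFRationalResolutionFRationalOfOneSop
import Summits.ResolutionOfSingularities.ResolutionOfSingularities.Theorems.FrobeniusLadderFRationalResolutionFRationalCM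
import HarnessLib

/-!
# Hochster–Huneke 1994, Prop. 6.27 (a), for quotients of regular local rings — unconditionally

Support file for crux stmt-ResolutionOfSingularities-15317 (`FrobeniusLadder.FRationalResolution`),
line `Sketch`, continuation seat c3, cycle 4, theme (C). For `R = S/Q`, `S` a regular local ring
of prime characteristic `p` and `Q` a prime ideal (so: every stalk of a variety), **if ONE ideal
generated by a system of parameters of `R` is tightly closed then EVERY such ideal is tightly closed
(`R` is F-rational) and `R` is Cohen–Macaulay** — the content of the named fact
`Literature.RingTheory.TightClosure.HochsterHuneke1994_prop627a` for this class of rings, with an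
ELEMENTARY proof: the exchange chain of `…FRationalOfOneSop.lean` (CM case, p145288) in which every
use of "parameters are non-zero-divisors" is replaced by the tree's COLON CAPTURING for `S/Q` with a
UNIFORM multiplier (`stub_colonCapturing_sop_pow`: `v sᵢ^m ∈ (s_{<i}^[q]) ⇒ c v^(p^N) ∈ (s_{<i}^[q p^N])`
with `c ≠ 0`, `N` depending only on `S, Q`), through the power step under colon capturing
(`stub_tc_power_step_cc`, multiplier `c · c_u^(p^N)`) and the Krull step (`stub_tc_of_powers`).
No local cohomology, no test elements, no transition determinants, no F-finiteness.

* `isTightlyClosed_exchange_cc`, `isTightlyClosed_of_append_cc`, `isTightlyClosed_parameterIdeal_of_one_cc`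
  — the abstract chain for a Noetherian local domain carrying a uniform colon-capturing datum;
* `fRationalClause_of_one_quotient` — **ONE tightly closed parameter ideal of `S/Q` ⇒ the F-rational
  clause of `FRationalModification` / `FRationalResolution`**;
* `isWeaklyRegular_of_one_quotient` — … **and every system of parameters is a weakly regular
  sequence** (Cohen–Macaulay), by `isWeaklyRegular_of_fRational_clause_quotient` (c1).

## References

* M. Hochster, C. Huneke, *F-regularity, test elements, and smooth base change*, Trans. AMS 346
  (1994), Thm. 4.2 (c)(d), Prop. 6.27 (a). [HochsterHuneke1994]
-/

-- single-problem summit: the doubled namespace component is forced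
set_option linter.dupNamespace false

open IsLocalRing RingTheory.Sequence Literature.RingTheory.TightClosure
open Literature.AlgebraicGeometry.Resolution
open Literature.RingTheory.RegularLocalRing (ofList_append_cons ofList_concat)

namespace Summit.ResolutionOfSingularities.ResolutionOfSingularities.Theorems.FRationalResolution

/-! The uniform colon-capturing datum `(c, N)` of a local ring `R` in LIST form, used as an
explicit hypothesis `hcc` below: for every parameter list `B ++ [a]` (length `dim R`, members of `𝔪`,
`𝔪`-primary ideal), `z a^m ∈ (B)^[p^e] ⇒ c z^(p^N) ∈ (B)^[p^(e+N)]`. -/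

/-- From the datum: if `(B, a)` is a parameter list and `(B)` is tightly closed then `a` is a
non-zero-divisor modulo `(B)` (`z a ∈ (B) ⇒ c z^(p^(e+N)) ∈ (B)^[p^(e+N)]` for all `e`, i.e.
`z ∈ (B)^* = (B)`). [cite: HochsterHuneke1994, Thm. 4.2 (c) (proof)] -/
theorem mem_of_mul_mem_of_datum (p : ℕ) [Fact p.Prime] {R : Type} [CommRing R] [IsDomain R]
    [CharP R p] [IsLocalRing R] {c : R} (hc : c ≠ 0) {N : ℕ} (hcc : ∀ (B : List R) (a : R), ((B ++ [a]).length : WithBot ℕ∞) = ringKrullDim R →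
      (∀ q ∈ B ++ [a], q ∈ maximalIdeal R) → (∃ M : ℕ, maximalIdeal R ^ M ≤ Ideal.ofList (B ++ [a])) →
      ∀ (e m : ℕ) (z : R), 0 < m → z * a ^ m ∈ frobeniusPower (p ^ e) (Ideal.ofList B) →
        c * z ^ p ^ N ∈ frobeniusPower (p ^ (e + N)) (Ideal.ofList B))
    (B : List R) (a : R) (hlen : ((B ++ [a]).length : WithBot ℕ∞) = ringKrullDim R)
    (hm : ∀ q ∈ B ++ [a], q ∈ maximalIdeal R) (hN : ∃ M : ℕ, maximalIdeal R ^ M ≤ Ideal.ofList (B ++ [a]))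
    (htc : IsTightlyClosed p (Ideal.ofList B)) (z : R) (hz : z * a ∈ Ideal.ofList B) :
    z ∈ Ideal.ofList B := by
  have hp : p.Prime := Fact.out
  have hmem : z ∈ tightClosure p (Ideal.ofList B) := by
    refine (mem_tightClosure_iff p).mpr ⟨c, (mem_minimalPrimesCompl_iff_ne_zero).mpr hc, N,
      fun E hE => ?_⟩
    obtain ⟨e, rfl⟩ := Nat.exists_eq_add_of_le' hE
    have h1 : z ^ p ^ e * a ^ p ^ e ∈ frobeniusPower (p ^ e) (Ideal.ofList B) := by
      rw [← mul_pow]; exact pow_mem_frobeniusPower hz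
    have h2 := hcc B a hlen hm hN e (p ^ e) (z ^ p ^ e) (pow_pos hp.pos e) h1
    rwa [← pow_mul, ← pow_add] at h2
  exact htc.le hmem

/-- **One exchange preserves tight closedness, under colon capturing.** `R` a Noetherian local domain
of prime characteristic `p` with a uniform colon-capturing datum `(c, N)`; if `(C, a, A)` is a
parameter list whose ideal is tightly closed and `(C, g, A)` is again `𝔪`-primary, then the ideal of
`(C, g, A)` is tightly closed: with `J = (C, A)`, `(J, a^M)` is tightly closed for all `M ≥ 1`
(`stub_tc_power_step_cc`), hence `J` is (`stub_tc_of_powers`), hence `a` is regular mod `J`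
(`mem_of_mul_mem_of_datum`), and `a^M ∈ (J, g)` for `M ≫ 0` gives `(J, g)` tightly closed
(`stub_tc_exchange`). [cite: HochsterHuneke1994, Thm. 4.2 (d), Prop. 6.27 (a)] -/
theorem isTightlyClosed_exchange_cc (p : ℕ) [Fact p.Prime] {R : Type} [CommRing R] [IsDomain R]
    [CharP R p] [IsNoetherianRing R] [IsLocalRing R] {c : R} (hc : c ≠ 0) {N : ℕ}
    (hcc : ∀ (B : List R) (a : R), ((B ++ [a]).length : WithBot ℕ∞) = ringKrullDim R →
      (∀ q ∈ B ++ [a], q ∈ maximalIdeal R) → (∃ M : ℕ, maximalIdeal R ^ M ≤ Ideal.ofList (B ++ [a])) →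
      ∀ (e m : ℕ) (z : R), 0 < m → z * a ^ m ∈ frobeniusPower (p ^ e) (Ideal.ofList B) →
        c * z ^ p ^ N ∈ frobeniusPower (p ^ (e + N)) (Ideal.ofList B))
    (C A : List R) {a g : R}
    (hlen : ((C ++ a :: A).length : WithBot ℕ∞) = ringKrullDim R)
    (hm : ∀ q ∈ C ++ a :: A, q ∈ maximalIdeal R) {M₀ : ℕ}
    (hM₀ : maximalIdeal R ^ M₀ ≤ Ideal.ofList (C ++ a :: A)) {N' : ℕ}
    (hN' : maximalIdeal R ^ N' ≤ Ideal.ofList (C ++ g :: A))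
    (htc : IsTightlyClosed p (Ideal.ofList (C ++ a :: A))) :
    IsTightlyClosed p (Ideal.ofList (C ++ g :: A)) := by
  have ha : a ∈ maximalIdeal R := hm a (by simp)
  have hmB : ∀ q ∈ C ++ A, q ∈ maximalIdeal R := fun q hq => hm q (by
    simp only [List.mem_append, List.mem_cons] at hq ⊢; tauto)
  set J : Ideal R := Ideal.ofList (C ++ A) with hJ
  have hJa : Ideal.ofList (C ++ a :: A) = J ⊔ Ideal.span {a} := by
    rw [ofList_append_cons, sup_comm]
  have hJg : Ideal.ofList (C ++ g :: A) = J ⊔ Ideal.span {g} := by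
    rw [ofList_append_cons, sup_comm]
  -- the reordered parameter list `(C ++ A) ++ [a]`
  have hlen' : (((C ++ A) ++ [a]).length : WithBot ℕ∞) = ringKrullDim R := by
    rw [← hlen]; simp
  have hm' : ∀ q ∈ (C ++ A) ++ [a], q ∈ maximalIdeal R := by
    intro q hq
    simp only [List.mem_append, List.mem_singleton] at hq
    rcases hq with hq | rfl
    · exact hmB q (List.mem_append.mpr hq)
    · exact ha
  have hNa : ∃ M : ℕ, maximalIdeal R ^ M ≤ Ideal.ofList ((C ++ A) ++ [a]) :=
    ⟨M₀, by rw [ofList_concat, ← ofList_append_cons]; exact hM₀⟩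
  -- colon capturing for `(J, a)`
  have hccJ : ∀ (e m : ℕ) (z : R), 0 < m → z * a ^ m ∈ frobeniusPower (p ^ e) J →
      c * z ^ p ^ N ∈ frobeniusPower (p ^ (e + N)) J := fun e m z hm0 hz =>
    hcc (C ++ A) a hlen' hm' hNa e m z hm0 hz
  -- power step: `(J, a^M)` tightly closed for all `M ≥ 1`
  have htcJa : IsTightlyClosed p (J ⊔ Ideal.span {a}) := hJa ▸ htc
  have hpow : ∀ M : ℕ, 0 < M → IsTightlyClosed p (J ⊔ Ideal.span {a ^ M}) := fun M hM =>
    stub_tc_power_step_cc p R J a c ((mem_minimalPrimesCompl_iff_ne_zero).mpr hc) N hccJ htcJa M hM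
  -- Krull: `J` tightly closed, so `a` is regular modulo `J`
  have htcJ : IsTightlyClosed p J := stub_tc_of_powers p R J a ha hpow
  have ha0 : ∀ z : R, z * a ∈ J → z ∈ J :=
    mem_of_mul_mem_of_datum p hc hcc (C ++ A) a hlen' hm' hNa htcJ
  -- `a^M ∈ (J, g)` with `M ≥ 1`: `a^M = w g + j`
  have haM : a ^ (N' + 1) ∈ J ⊔ Ideal.span {g} := by
    rw [← hJg]
    exact hN' (Ideal.pow_le_pow_right (Nat.le_succ N') (Ideal.pow_mem_pow ha (N' + 1)))
  obtain ⟨j, hj, s, hs, hjs⟩ := Submodule.mem_sup.mp haM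
  obtain ⟨w, rfl⟩ := Ideal.mem_span_singleton'.mp hs
  rw [hJg]
  exact stub_tc_exchange p R J a g w j (N' + 1) hj (by rw [← hjs, add_comm]) ha0
    (hpow (N' + 1) (Nat.succ_pos N'))

/-- **The exchange chain under colon capturing** (cf. `isTightlyClosed_of_append`): two parameter
lists with a common prefix and tails of equal length; the second is tightly closed as soon as the
first is. [cite: HochsterHuneke1994, Thm. 4.2 (d)] -/
theorem isTightlyClosed_of_append_cc (p : ℕ) [Fact p.Prime] {R : Type} [CommRing R] [IsDomain R]
    [CharP R p] [IsNoetherianRing R] [IsLocalRing R] {c : R} (hc : c ≠ 0) {N : ℕ}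
    (hcc : ∀ (B : List R) (a : R), ((B ++ [a]).length : WithBot ℕ∞) = ringKrullDim R →
      (∀ q ∈ B ++ [a], q ∈ maximalIdeal R) → (∃ M : ℕ, maximalIdeal R ^ M ≤ Ideal.ofList (B ++ [a])) →
      ∀ (e m : ℕ) (z : R), 0 < m → z * a ^ m ∈ frobeniusPower (p ^ e) (Ideal.ofList B) →
        c * z ^ p ^ N ∈ frobeniusPower (p ^ (e + N)) (Ideal.ofList B))
    (m : ℕ) : ∀ (C A₁ A₂ : List R), A₁.length = m →
    A₂.length = m → ((C ++ A₁).length : WithBot ℕ∞) = ringKrullDim R →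
    (∀ q ∈ C ++ A₁, q ∈ maximalIdeal R) → (∀ q ∈ C ++ A₂, q ∈ maximalIdeal R) →
    (∀ N₁ N₂ : ℕ, maximalIdeal R ^ N₁ ≤ Ideal.ofList (C ++ A₁) →
      maximalIdeal R ^ N₂ ≤ Ideal.ofList (C ++ A₂) →
    IsTightlyClosed p (Ideal.ofList (C ++ A₁)) → IsTightlyClosed p (Ideal.ofList (C ++ A₂))) := by
  induction m with
  | zero =>
    intro C A₁ A₂ h₁ h₂ _ _ _ _ _ _ _ h
    rw [List.length_eq_zero_iff.mp h₁] at h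
    rwa [List.length_eq_zero_iff.mp h₂]
  | succ m ih =>
    intro C A₁ A₂ h₁ h₂ hlen hm₁ hm₂ N₁ N₂ hN₁ hN₂ htc
    obtain ⟨a₁, A₁', rfl⟩ := List.exists_cons_of_length_eq_add_one h₁
    obtain ⟨a₂, A₂', rfl⟩ := List.exists_cons_of_length_eq_add_one h₂
    simp only [List.length_cons, Nat.add_right_cancel_iff] at h₁ h₂
    have ha₁ : a₁ ∈ maximalIdeal R := hm₁ a₁ (by simp)
    have ha₂ : a₂ ∈ maximalIdeal R := hm₂ a₂ (by simp)
    have hlen₂ : ((C ++ a₂ :: A₂').length : WithBot ℕ∞) = ringKrullDim R := by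
      rw [← hlen]; simp [h₁, h₂]
    have hlt : ∀ A' : List R, A'.length = m →
        ((C ++ A').length : WithBot ℕ∞) < ringKrullDim R := fun A' hA' => by
      rw [← hlen]
      have : (C ++ A').length < (C ++ a₁ :: A₁').length := by simp [hA', h₁]
      exact_mod_cast this
    rw [ofList_append_cons] at hN₁ hN₂
    obtain ⟨g, hg, ⟨M₁, hM₁⟩, ⟨M₂, hM₂⟩⟩ :=
      socleOne_exists_exchange (C ++ A₁') (C ++ A₂') (hlt A₁' h₁) (hlt A₂' h₂) ha₁ ha₂ hN₁ hN₂
    rw [← ofList_append_cons] at hN₁ hN₂ hM₁ hM₂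
    have hmg : ∀ {A' : List R} {a : R}, (∀ q ∈ C ++ a :: A', q ∈ maximalIdeal R) →
        ∀ q ∈ C ++ g :: A', q ∈ maximalIdeal R := fun hm q hq => by
      simp only [List.mem_append, List.mem_cons] at hq
      rcases hq with hq | rfl | hq
      · exact hm q (List.mem_append_left _ hq)
      · exact hg
      · exact hm q (by simp [hq])
    have h1 : IsTightlyClosed p (Ideal.ofList (C ++ g :: A₁')) :=
      isTightlyClosed_exchange_cc p hc hcc C A₁' hlen hm₁ hN₁ hM₁ htc
    have key := ih (C ++ [g]) A₁' A₂' h₁ h₂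
    simp only [List.append_assoc, List.singleton_append] at key
    have h2 : IsTightlyClosed p (Ideal.ofList (C ++ g :: A₂')) :=
      key (by rw [← hlen]; simp) (hmg hm₁) (hmg hm₂) M₁ M₂ hM₁ hM₂ h1
    have hleng : ((C ++ g :: A₂').length : WithBot ℕ∞) = ringKrullDim R := by
      rw [← hlen₂]; simp
    exact isTightlyClosed_exchange_cc p hc hcc C A₂' hleng (hmg hm₂) hM₂ hN₂ h2

/-- **One tightly closed parameter ideal makes all of them tightly closed, under colon capturing**
(list form). [cite: HochsterHuneke1994, Thm. 4.2 (d), Prop. 6.27 (a)] -/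
theorem isTightlyClosed_parameterIdeal_of_one_cc (p : ℕ) [Fact p.Prime] (R : Type) [CommRing R]
    [IsDomain R] [CharP R p] [IsNoetherianRing R] [IsLocalRing R] {c : R} (hc : c ≠ 0) {N : ℕ}
    (hcc : ∀ (B : List R) (a : R), ((B ++ [a]).length : WithBot ℕ∞) = ringKrullDim R →
      (∀ q ∈ B ++ [a], q ∈ maximalIdeal R) → (∃ M : ℕ, maximalIdeal R ^ M ≤ Ideal.ofList (B ++ [a])) →
      ∀ (e m : ℕ) (z : R), 0 < m → z * a ^ m ∈ frobeniusPower (p ^ e) (Ideal.ofList B) →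
        c * z ^ p ^ N ∈ frobeniusPower (p ^ (e + N)) (Ideal.ofList B))
    (Q₁ Q₂ : List R) (h₁ : (Q₁.length : WithBot ℕ∞) = ringKrullDim R)
    (h₂ : (Q₂.length : WithBot ℕ∞) = ringKrullDim R)
    (hm₁ : ∀ q ∈ Q₁, q ∈ maximalIdeal R) (hm₂ : ∀ q ∈ Q₂, q ∈ maximalIdeal R)
    (N₁ N₂ : ℕ) (hN₁ : maximalIdeal R ^ N₁ ≤ Ideal.ofList Q₁)
    (hN₂ : maximalIdeal R ^ N₂ ≤ Ideal.ofList Q₂) (htc : IsTightlyClosed p (Ideal.ofList Q₁)) :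
    IsTightlyClosed p (Ideal.ofList Q₂) := by
  have hlen : Q₂.length = Q₁.length := by
    have := h₂.trans h₁.symm
    exact_mod_cast this
  have h := isTightlyClosed_of_append_cc p hc hcc Q₁.length [] Q₁ Q₂ rfl hlen
    (by simpa using h₁) (by simpa using hm₁) (by simpa using hm₂) N₁ N₂ (by simpa using hN₁)
    (by simpa using hN₂)
  simp only [List.nil_append] at h
  exact h htc

/-- Dictionary: for a system of parameters `s : Fin d → R` (`dim R = d`, maximal radical), the list
`List.ofFn s` has ideal `(s)`, length `dim R`, members in `𝔪`, and `𝔪`-primary ideal. [folklore] -/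
theorem sop_list_data {R : Type} [CommRing R] [IsNoetherianRing R] [IsLocalRing R] {d : ℕ}
    (s : Fin d → R) (hd : ringKrullDim R = d) (hs : (Ideal.span (Set.range s)).radical.IsMaximal) :
    Ideal.ofList (List.ofFn s) = Ideal.span (Set.range s) ∧
      ((List.ofFn s).length : WithBot ℕ∞) = ringKrullDim R ∧
      (∀ q ∈ List.ofFn s, q ∈ maximalIdeal R) ∧
      ∃ M : ℕ, maximalIdeal R ^ M ≤ Ideal.ofList (List.ofFn s) := by
  have hspan : Ideal.ofList (List.ofFn s) = Ideal.span (Set.range s) := by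
    rw [Ideal.ofList]
    congr 1
    ext q
    simp [List.mem_ofFn']
  have hmax : (Ideal.span (Set.range s)).radical = maximalIdeal R := IsLocalRing.eq_maximalIdeal hs
  refine ⟨hspan, by rw [List.length_ofFn, hd], fun q hq => ?_, ?_⟩
  · rw [← hmax]
    exact Ideal.le_radical (hspan ▸ Ideal.subset_span hq)
  · rw [hspan]
    exact Ideal.exists_pow_le_of_le_radical_of_fg (hmax ▸ le_rfl) (IsNoetherian.noetherian _)

/-- **The colon-capturing datum of `S/Q`** (`S` regular local of characteristic `p`, `Q` prime), in
list form, from `stub_colonCapturing_sop_pow`. [cite: HochsterHuneke1994, Thm. 4.2 (c) / HH90 Thm. 7.15] -/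
theorem exists_colonCapturingDatum_quotient (p : ℕ) [Fact p.Prime] (S : Type) [CommRing S]
    [IsRegularLocalRing S] [CharP S p] (Q : Ideal S) [Q.IsPrime] [IsLocalRing (S ⧸ Q)] :
    ∃ c : S ⧸ Q, c ≠ 0 ∧ ∃ N : ℕ,
    (∀ (B : List (S ⧸ Q)) (a : S ⧸ Q), ((B ++ [a]).length : WithBot ℕ∞) = ringKrullDim (S ⧸ Q) →
      (∀ q ∈ B ++ [a], q ∈ maximalIdeal (S ⧸ Q)) → (∃ M : ℕ, maximalIdeal (S ⧸ Q) ^ M ≤ Ideal.ofList (B ++ [a])) →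
      ∀ (e m : ℕ) (z : S ⧸ Q), 0 < m → z * a ^ m ∈ frobeniusPower (p ^ e) (Ideal.ofList B) →
        c * z ^ p ^ N ∈ frobeniusPower (p ^ (e + N)) (Ideal.ofList B)) := by
  haveI : CharP (S ⧸ Q) p := charP_quotient_of_ne_top p Q ‹Q.IsPrime›.ne_top
  obtain ⟨d, hd⟩ := exists_nat_cast_eq_ringKrullDim (R := S ⧸ Q)
  obtain ⟨c, hc, N, hcc⟩ := stub_colonCapturing_sop_pow p S Q hd
  refine ⟨c, hc, N, fun B a hlen hm hM e m z hm0 hz => ?_⟩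
  -- the parameter list as a family `s : Fin d → S/Q`, `a` last
  have hlenB : (B ++ [a]).length = d := by
    have := hlen.trans hd
    exact_mod_cast this
  have hBd : B.length + 1 = d := by simpa using hlenB
  let s : Fin d → S ⧸ Q := fun j => (B ++ [a]).get (j.cast hlenB.symm)
  have hs_range : Set.range s = {x | x ∈ B ++ [a]} := by
    ext x
    simp only [Set.mem_range, Set.mem_setOf_eq, s]
    constructor
    · rintro ⟨j, rfl⟩; exact List.get_mem _ _
    · intro hx
      obtain ⟨j, hj⟩ := List.get_of_mem hx
      exact ⟨j.cast hlenB, by rw [← hj]; rfl⟩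
  have hspan : Ideal.span (Set.range s) = Ideal.ofList (B ++ [a]) := by rw [hs_range, Ideal.ofList]
  have hrad : (Ideal.span (Set.range s)).radical.IsMaximal := by
    rw [hspan]
    obtain ⟨M, hMle⟩ := hM
    have hle : Ideal.ofList (B ++ [a]) ≤ maximalIdeal (S ⧸ Q) := Ideal.span_le.mpr fun q hq => hm q hq
    have heq : (Ideal.ofList (B ++ [a])).radical = maximalIdeal (S ⧸ Q) := by
      refine le_antisymm ?_ ?_
      · exact (Ideal.radical_mono hle).trans
          ((Ideal.IsPrime.radical_le_iff inferInstance).mpr le_rfl)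
      · intro x hx; exact ⟨M, hMle (Ideal.pow_mem_pow hx M)⟩
    rw [heq]; exact IsLocalRing.maximalIdeal.isMaximal _
  -- the last index and its prefix
  let i : Fin d := ⟨B.length, by omega⟩
  have hsi : s i = a := by
    show (B ++ [a])[B.length]'(by simp) = a
    rw [List.getElem_append_right (Nat.le_refl _)]
    simp
  have hprefix : ∀ q : ℕ, (fun j : Fin d => s j ^ q) '' Set.Iio i =
      (fun x : S ⧸ Q => x ^ q) '' {x | x ∈ B} := by
    intro q
    ext y
    simp only [Set.mem_image, Set.mem_Iio, Set.mem_setOf_eq]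
    constructor
    · rintro ⟨j, hj, rfl⟩
      have hjlt : (j : ℕ) < B.length := hj
      refine ⟨s j, ?_, rfl⟩
      show (B ++ [a]).get _ ∈ B
      simp [List.getElem_append_left hjlt]
    · rintro ⟨x, hx, rfl⟩
      obtain ⟨k, hk⟩ := List.get_of_mem hx
      refine ⟨⟨k, by omega⟩, (show (k : ℕ) < B.length from k.2), ?_⟩
      show (B ++ [a]).get _ ^ q = x ^ q
      congr 1
      rw [← hk]
      simp [List.getElem_append_left k.2]
  have hfrob : ∀ q : ℕ, ∀ E : ℕ, q = p ^ E →
      frobeniusPower q (Ideal.ofList B) = Ideal.span ((fun j : Fin d => s j ^ q) '' Set.Iio i) := by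
    intro q E hq
    subst hq
    rw [Ideal.ofList, frobeniusPower_span, hprefix]
  have hz' : z * s i ^ m ∈ Ideal.span ((fun j : Fin d => s j ^ p ^ e) '' Set.Iio i) := by
    rw [hsi, ← hfrob (p ^ e) e rfl]; exact hz
  have h := hcc s hrad i e m z hm0 hz'
  rwa [← hfrob (p ^ (e + N)) (e + N) rfl] at h

/-- **HOCHSTER–HUNEKE 1994, PROP. 6.27 (a), FOR QUOTIENTS OF REGULAR LOCAL RINGS.** Let `S` be a
regular local ring of prime characteristic `p` and `Q` a prime ideal. If ONE system of parameters
`s₀` of `S/Q` (`dim` elements generating an ideal with maximal radical) generates an ideal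
satisfying the tight-closure clause (`c ≠ 0`, `c y^q ∈ (s₀)^[q]` for all `q` ⇒ `y ∈ (s₀)`), then
EVERY system of parameters of `S/Q` does: `S/Q` satisfies the F-rational clause of
`FRationalModification` / `FRationalResolution` (no Cohen–Macaulay hypothesis; compare the CM case
`fRationalClause_of_one`). [cite: HochsterHuneke1994, Prop. 6.27 (a), Thm. 4.2 (d)] -/
theorem fRationalClause_of_one_quotient (p : ℕ) [Fact p.Prime] (S : Type) [CommRing S]
    [IsRegularLocalRing S] [CharP S p] (Q : Ideal S) [Q.IsPrime] [IsLocalRing (S ⧸ Q)]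
    {d₀ : ℕ} (hd₀ : ringKrullDim (S ⧸ Q) = d₀) (s₀ : Fin d₀ → S ⧸ Q)
    (hs₀ : (Ideal.span (Set.range s₀)).radical.IsMaximal)
    (htc₀ : ∀ y c : S ⧸ Q, c ≠ 0 → (∀ e : ℕ, c * y ^ p ^ e ∈
      Ideal.span ((fun z : S ⧸ Q => z ^ p ^ e) '' (Ideal.span (Set.range s₀) : Set (S ⧸ Q)))) →
      y ∈ Ideal.span (Set.range s₀)) :
    ∀ d : ℕ, ringKrullDim (S ⧸ Q) = d → ∀ s : Fin d → S ⧸ Q,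
      (Ideal.span (Set.range s)).radical.IsMaximal → ∀ y c : S ⧸ Q, c ≠ 0 →
      (∀ e : ℕ, c * y ^ p ^ e ∈
        Ideal.span ((fun z : S ⧸ Q => z ^ p ^ e) '' (Ideal.span (Set.range s) : Set (S ⧸ Q)))) →
        y ∈ Ideal.span (Set.range s) := by
  haveI : IsDomain S := isDomain_of_isRegularLocalRing S
  haveI : IsDomain (S ⧸ Q) := Ideal.Quotient.isDomain Q
  have hQtop : Q ≠ ⊤ := ‹Q.IsPrime›.ne_top
  haveI : CharP (S ⧸ Q) p := charP_quotient_of_ne_top p Q hQtop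
  obtain ⟨c, hc, N, hcc⟩ := exists_colonCapturingDatum_quotient p S Q
  obtain ⟨hspan₀, hlen₀, hm₀, N₀, hN₀⟩ := sop_list_data s₀ hd₀ hs₀
  have htc₀' : IsTightlyClosed p (Ideal.ofList (List.ofFn s₀)) := by
    rw [hspan₀]
    exact (isTightlyClosed_iff_of_isDomain p).mpr htc₀
  intro d hd s hs
  obtain ⟨hspan, hlen, hm, M, hM⟩ := sop_list_data s hd hs
  have h := isTightlyClosed_parameterIdeal_of_one_cc p (S ⧸ Q) hc hcc (List.ofFn s₀) (List.ofFn s)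
    hlen₀ hlen hm₀ hm N₀ M hN₀ hM htc₀'
  rw [hspan] at h
  exact (isTightlyClosed_iff_of_isDomain p).mp h

/-- **… and `S/Q` is then Cohen–Macaulay**: every system of parameters is a weakly regular sequence
(`isWeaklyRegular_of_fRational_clause_quotient`, c1, colon capturing). Together with
`fRationalClause_of_one_quotient` this is Prop. 6.27 (a) of Hochster–Huneke 1994 for quotients of
regular local rings. [cite: HochsterHuneke1994, Prop. 6.27 (a)] -/
theorem isWeaklyRegular_of_one_quotient (p : ℕ) [Fact p.Prime] (S : Type) [CommRing S]
    [IsRegularLocalRing S] [CharP S p] (Q : Ideal S) [Q.IsPrime] [IsLocalRing (S ⧸ Q)]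
    {d₀ : ℕ} (hd₀ : ringKrullDim (S ⧸ Q) = d₀) (s₀ : Fin d₀ → S ⧸ Q)
    (hs₀ : (Ideal.span (Set.range s₀)).radical.IsMaximal)
    (htc₀ : ∀ y c : S ⧸ Q, c ≠ 0 → (∀ e : ℕ, c * y ^ p ^ e ∈
      Ideal.span ((fun z : S ⧸ Q => z ^ p ^ e) '' (Ideal.span (Set.range s₀) : Set (S ⧸ Q)))) →
      y ∈ Ideal.span (Set.range s₀))
    {d : ℕ} (hd : ringKrullDim (S ⧸ Q) = d) (s : Fin d → S ⧸ Q)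
    (hs : (Ideal.span (Set.range s)).radical.IsMaximal) :
    IsWeaklyRegular (S ⧸ Q) (List.ofFn s) :=
  isWeaklyRegular_of_fRational_clause_quotient p S Q
    (fRationalClause_of_one_quotient p S Q hd₀ s₀ hs₀ htc₀) hd s hs

/-- **Prop. 6.27 (a) of Hochster–Huneke 1994 for `S/Q`, in the vocabulary of the named fact
`Literature.RingTheory.TightClosure.HochsterHuneke1994_prop627a`**: if one system of parameters of
`R = S/Q` (`S` regular local of characteristic `p`, `Q` prime) generates a tightly closed ideal, then
`R` has a regular sequence in `𝔪` of length `dim R` (Cohen–Macaulay) and is F-rational — no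
excellence or equidimensionality hypothesis is needed for this class (it is a domain); the instance
`CharP (S ⧸ Q) p` is `charP_quotient_of_ne_top`.
[cite: HochsterHuneke1994, Prop. 6.27 (a)] -/
theorem prop627a_quotient (p : ℕ) [Fact p.Prime] (S : Type) [CommRing S] [IsRegularLocalRing S]
    [CharP S p] (Q : Ideal S) [Q.IsPrime] [IsLocalRing (S ⧸ Q)] [CharP (S ⧸ Q) p] (d : ℕ)
    (hd : ringKrullDim (S ⧸ Q) = d)
    (h : ∃ s : Fin d → S ⧸ Q, IsSystemOfParameters s ∧ IsTightlyClosed p (Ideal.span (Set.range s))) :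
    (∃ rs : List (S ⧸ Q), IsRegular (S ⧸ Q) rs ∧ (∀ r ∈ rs, r ∈ maximalIdeal (S ⧸ Q)) ∧
      rs.length = d) ∧ IsFRational (S ⧸ Q) p := by
  haveI : IsDomain S := isDomain_of_isRegularLocalRing S
  haveI : IsDomain (S ⧸ Q) := Ideal.Quotient.isDomain Q
  obtain ⟨s₀, hs₀, htc₀⟩ := h
  obtain ⟨hd₀, hrad₀⟩ := isSystemOfParameters_iff.mp hs₀
  have hclause := fRationalClause_of_one_quotient p S Q hd s₀ hrad₀
    ((isTightlyClosed_iff_of_isDomain p).mp htc₀)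
  refine ⟨⟨List.ofFn s₀, ?_, ?_, by rw [List.length_ofFn]⟩,
    (isFRational_iff_of_isDomain p).mpr hclause⟩
  · have hw : IsWeaklyRegular (S ⧸ Q) (List.ofFn s₀) :=
      isWeaklyRegular_of_fRational_clause_quotient p S Q hclause hd s₀ hrad₀
    obtain ⟨hspan, -, hm, -⟩ := sop_list_data s₀ hd hrad₀
    refine ⟨hw, ?_⟩
    -- `(s₀) ≠ ⊤` since `s₀ ⊆ 𝔪`
    intro htop
    have hle : Ideal.ofList (List.ofFn s₀) ≤ maximalIdeal (S ⧸ Q) :=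
      Ideal.span_le.mpr fun q hq => hm q hq
    have h1 : (1 : S ⧸ Q) ∈ (Ideal.ofList (List.ofFn s₀) • ⊤ : Submodule (S ⧸ Q) (S ⧸ Q)) := by
      rw [← htop]; exact Submodule.mem_top
    rw [Ideal.smul_eq_mul, Ideal.mul_top] at h1
    exact (maximalIdeal.isMaximal (S ⧸ Q)).ne_top ((Ideal.eq_top_iff_one _).mpr (hle h1))
  · obtain ⟨-, -, hm, -⟩ := sop_list_data s₀ hd hrad₀
    exact hm

end Summit.ResolutionOfSingularities.ResolutionOfSingularities.Theorems.FRationalResolution
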